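import Mathlib
import Literature.Analysis.FluidPDE.Tao2016AveragedNS.SelfSimilarCascadeBlowup
import Summits.NavierStokesRegularity.NavierStokesRegularity.Theorems.TaoLadderRungTwoBreakBlowupRigidityOneCriticalBlowup
import Summits.NavierStokesRegularity.NavierStokesRegularity.Theorems.TaoLadderRungTwoBreakBlowupRigidityOneCriticalRiccati
import HarnessLib

/-!
# The blow-up RATE of the exact cascade lattice is AT LEAST TYPE I in the critical amplitude, part 2/2:
  `sup_{i,k} Λ^k |X_{i,k}(t)| ≥ 1/(C₁ (T⋆ - t))` along the maximal exact flow of a robustly blowing-up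
  table — NON-DEGENERACY of the self-similar renormalisation (support for the extraction stub
  `stub_eternalFromBlowup` of K2(1) `TaoLadderRungTwoBreak.BlowupRigidityOne`, stmt-NavierStokesRegularity-20206)

MODEL lattice ODEs only (Tao 2016 §4 (4.12)); nothing here is a statement about the Navier–Stokes equations;
NO item is closed (`--supports stmt-NavierStokesRegularity-20206`). Route-independent; general `m`.

* `critical_rate_lower_bound` — if the critical amplitude of an exact flow ((4.5)-regular before `T`) is
  unbounded on `[0,T)`, then at EVERY `s < T` it is at least `1/(C₁(T-s))`, `C₁ = m² M_α (3 + Λ)`: for every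
  `L` with `L·C₁(T-s) < 1` some mode has `Λ^k|X_{i,k}(s)| > L` (by the Riccati comparison
  `critical_le_riccati` of part 1 with a slightly larger constant, a smaller value would keep the critical
  amplitude bounded up to `T`);
* `criticalRate_of_noGlobalCascade` — along the maximal exact flow of a robustly blowing-up `E₂(R)` table
  (`criticalBlowup_of_noGlobalCascade`): `(T⋆ - t)·sup_{i,k} Λ^k|X_{i,k}(t)| ≥ 1/(m²(3+Λ))` on `[0,T⋆)` —
  in the self-similar variables of the extraction stub (`…RenormalisedFlow.renormalisedFlow_norm`) the
  renormalised trajectory `W` never enters the sup-norm ball of radius `1/(m²(3+Λ))`, so no ω-limit of it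
  can be trivial. The UPPER bound (type I, N-39) remains open.
-/

noncomputable section

-- the summit and its single sub-problem share the name (CONVENTIONS §1)
set_option linter.dupNamespace false

open Set Filter Topology

namespace Summit.NavierStokesRegularity.NavierStokesRegularity.Theorems

namespace BlowupRigidityOne

open Literature.Analysis.FluidPDE Literature.Analysis.FluidPDE.TaoCascade

variable {m : ℕ}

/-! ### The rate lower bound -/

/-- **THE BLOW-UP RATE IS AT LEAST TYPE I.** Same setting (`C₁ = m² M_α (3 + Λ)`). If the critical
amplitude is UNBOUNDED on `[0,T)` (`∀ L, ∃ t < T, ∃ i k, L < (1+ε₀)^{5k/2}|X_{i,k}(t)|`), then at every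
`s ∈ [0,T)` and for every `L` with `L · C₁ (T - s) < 1` some mode has `(1+ε₀)^{5k/2}|X_{i,k}(s)| > L` — i.e.
`sup_{i,k} Λ^k|X_{i,k}(s)| ≥ 1/(C₁(T-s))`. (Otherwise a Riccati comparison with a slightly larger constant
keeps the critical amplitude bounded up to `T`.) [cite: Teschl2012, §2.6; Tao2016AveragedNS, §4 (4.8), (4.12)] -/
theorem critical_rate_lower_bound {ε₀ Mα T : ℝ} (hε : 0 ≤ ε₀) (hMα : 0 ≤ Mα)
    {α : Fin m → Fin m → Fin m → ℤ × ℤ × ℤ → ℝ} (hα : ∀ i₁ i₂ i₃ μ, |α i₁ i₂ i₃ μ| ≤ Mα)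
    {X : Fin m → ℤ → ℝ → ℝ}
    (hder : ∀ i k, ∀ t ∈ Ico 0 T, HasDerivWithinAt (X i k) (quadTerm ε₀ α X i k t) (Ici 0) t)
    (hreg : ∀ T' : ℝ, T' < T → ∃ M : ℝ, ∀ t ∈ Icc 0 T', ∀ (i : Fin m) (k : ℤ),
      (1 + (1 + ε₀) ^ ((10 : ℝ) * k)) * |X i k t| ≤ M)
    (hunb : ∀ L : ℝ, ∃ t ∈ Ico (0 : ℝ) T, ∃ (i : Fin m) (k : ℤ),
      L < (1 + ε₀) ^ ((5 : ℝ) * k / 2) * |X i k t|) :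
    ∀ s ∈ Ico (0 : ℝ) T, ∀ L : ℝ, L * ((m : ℝ) ^ 2 * Mα * (3 + bigLam ε₀) * (T - s)) < 1 →
      ∃ (i : Fin m) (k : ℤ), L < (1 + ε₀) ^ ((5 : ℝ) * k / 2) * |X i k s| := by
  intro s hs L hL
  by_contra hcon
  push Not at hcon
  -- `hcon : ∀ i k, (1+ε₀)^{5k/2} |X i k s| ≤ L`
  obtain ⟨t₀, -, i₀, -, -⟩ := hunb 0
  set C₁ : ℝ := (m : ℝ) ^ 2 * Mα * (3 + bigLam ε₀) with hC₁def
  have hLam : 0 < bigLam ε₀ := bigLam_pos (by linarith)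
  have hC₁0 : 0 ≤ C₁ := by positivity
  have hL0 : 0 ≤ L := le_trans (mul_nonneg (Real.rpow_nonneg (by linarith) _) (abs_nonneg _)) (hcon i₀ 0)
  have hTs : 0 < T - s := by linarith [hs.2]
  -- choose `θ > 0` with `(C₁ + θ)(L + θ)(T - s) < 1`
  have hθev : ∀ᶠ θ in 𝓝[>] (0 : ℝ), (C₁ + θ) * (L + θ) * (T - s) < 1 := by
    have hc : ContinuousAt (fun θ : ℝ => (C₁ + θ) * (L + θ) * (T - s)) 0 := by fun_prop
    have hlim : Tendsto (fun θ : ℝ => (C₁ + θ) * (L + θ) * (T - s)) (𝓝[>] 0)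
        (𝓝 ((C₁ + 0) * (L + 0) * (T - s))) := hc.tendsto.mono_left nhdsWithin_le_nhds
    refine hlim (Iio_mem_nhds ?_)
    simp only [add_zero]
    linarith [mul_comm L (C₁ * (T - s)), mul_assoc C₁ (T - s) L, mul_assoc C₁ L (T - s),
      mul_comm (T - s) L]
  obtain ⟨θ, hθ1, hθ⟩ := (hθev.and self_mem_nhdsWithin).exists
  have hθ : 0 < θ := hθ
  have hA : 0 < L + θ := by linarith
  have hgap : (C₁ + θ) * (L + θ) * (T - s) < 1 := hθ1
  -- the comparison bounds the critical amplitude on `[s,T)` ...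
  have hric := critical_le_riccati hε hMα hα hder hreg hs hA
    (fun i k => (hcon i k).trans (by linarith)) (by linarith : C₁ < C₁ + θ) hgap
  -- ... and (4.5)-regularity bounds it on `[0,s]`
  obtain ⟨M, hM⟩ := hreg s hs.2
  have hl1 : (1 : ℝ) ≤ 1 + ε₀ := by linarith
  have hl0 : (0 : ℝ) < 1 + ε₀ := by linarith
  have hPW : ∀ k : ℤ, (1 + ε₀) ^ ((5 : ℝ) * k / 2) ≤ 1 + (1 + ε₀) ^ ((10 : ℝ) * k) := by
    intro k
    rcases le_or_gt 0 k with hk | hk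
    · have : (1 + ε₀) ^ ((5 : ℝ) * k / 2) ≤ (1 + ε₀) ^ ((10 : ℝ) * k) := by
        refine Real.rpow_le_rpow_of_exponent_le hl1 ?_
        have : (0 : ℝ) ≤ k := by exact_mod_cast hk
        linarith
      linarith
    · have : (1 + ε₀) ^ ((5 : ℝ) * k / 2) ≤ 1 := by
        refine Real.rpow_le_one_of_one_le_of_nonpos hl1 ?_
        have : (k : ℝ) ≤ 0 := by exact_mod_cast hk.le
        linarith
      linarith [Real.rpow_nonneg hl0.le ((10 : ℝ) * k)]
  obtain ⟨t, ht, i, k, hlt⟩ := hunb (max M ((L + θ) / (1 - (C₁ + θ) * (L + θ) * (T - s))))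
  rcases lt_or_ge t s with hts | hts
  · have h1 := hM t ⟨ht.1, hts.le⟩ i k
    have h2 : (1 + ε₀) ^ ((5 : ℝ) * k / 2) * |X i k t| ≤ M :=
      (mul_le_mul_of_nonneg_right (hPW k) (abs_nonneg _)).trans h1
    exact absurd (lt_of_lt_of_le hlt h2) (not_lt.2 (le_max_left _ _))
  · have h2 := hric t ⟨hts, ht.2⟩ i k
    exact absurd (lt_of_lt_of_le hlt h2) (not_lt.2 (le_max_right _ _))

/-- **NON-DEGENERACY OF THE RENORMALISED BLOW-UP of a robustly blowing-up table.** If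
`NoGlobalCascade ε₀ α X₀` (`ε₀ > 0`, `α ∈ E₂(R)`, any `m`), then along the maximal exact cascade flow `X`
from the one-shell datum (`criticalBlowup_of_noGlobalCascade`: `[0,T⋆)`, `C¹`, datum, no shells below `0`,
exact motion, (4.5)-regular before `T⋆`, critical amplitude unbounded) the type-I quantity is bounded BELOW:
for every `t ∈ [0,T⋆)` and every `L` with `L · m²(3+Λ)(T⋆ - t) < 1` some mode has
`(1+ε₀)^{5k/2}|X_{i,k}(t)| > L`, i.e. `(T⋆ - t) · sup_{i,k} Λ^k |X_{i,k}(t)| ≥ 1/(m²(3+Λ))` — in the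
self-similar variables of the extraction stub, `sup_n ‖W_n(σ)‖ ≥ 1/(m²(3+Λ))` at every log-time.
[cite: Tao2016AveragedNS, §4 Thm. 4.2, (4.12), §6.4; Teschl2012, §2.6] -/
theorem criticalRate_of_noGlobalCascade {ε₀ R : ℝ} (hε : 0 < ε₀)
    {α : Fin m → Fin m → Fin m → ℤ × ℤ × ℤ → ℝ} {X₀ : Fin m → ℝ} (hα : InTableClass R α)
    (hNG : NoGlobalCascade ε₀ α X₀) :
    ∃ (T : ℝ) (X : Fin m → ℤ → ℝ → ℝ), 0 < T ∧
      (∀ i n, ContDiffOn ℝ 1 (X i n) (Set.Ico 0 T)) ∧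
      (∀ i n, X i n 0 = if n = 0 then X₀ i else 0) ∧
      (∀ i n t, n < 0 → X i n t = 0) ∧
      (∀ i n t, 0 ≤ t → t < T → derivWithin (X i n) (Set.Ici 0) t = quadTerm ε₀ α X i n t) ∧
      (∀ T' : ℝ, 0 < T' → T' < T → ∃ M : ℝ, ∀ t : ℝ, 0 ≤ t → t ≤ T' →
        ∀ (i : Fin m) (n : ℤ), (1 + (1 + ε₀) ^ ((10 : ℝ) * n)) * |X i n t| ≤ M) ∧
      (∀ t ∈ Ico (0 : ℝ) T, ∀ L : ℝ, L * ((m : ℝ) ^ 2 * (3 + bigLam ε₀) * (T - t)) < 1 →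
        ∃ (i : Fin m) (k : ℤ), L < (1 + ε₀) ^ ((5 : ℝ) * k / 2) * |X i k t|) := by
  obtain ⟨T, X, hT, h1, h2, h3, h4, h5, h6⟩ := criticalBlowup_of_noGlobalCascade hε hα hNG
  refine ⟨T, X, hT, h1, h2, h3, h4, h5, fun t ht L hL => ?_⟩
  -- restricted table (bounded by `1`, same nonlinearity)
  have hα' := abs_restrictShiftSet_le zero_le_one (abs_le_one_of_inTableClass hα)
  have hder : ∀ i k, ∀ τ ∈ Ico (0 : ℝ) T,
      HasDerivWithinAt (X i k) (quadTerm ε₀ (restrictShiftSet α) X i k τ) (Ici 0) τ := by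
    intro i k τ hτ
    have hd : DifferentiableWithinAt ℝ (X i k) (Ico 0 T) τ :=
      ((h1 i k).differentiableOn one_ne_zero) τ hτ
    have hd' : DifferentiableWithinAt ℝ (X i k) (Ici 0) τ :=
      hd.mono_of_mem_nhdsWithin (by
        rw [mem_nhdsWithin]
        exact ⟨Iio T, isOpen_Iio, hτ.2, fun x hx => ⟨hx.2, hx.1⟩⟩)
    rw [quadTerm_restrictShiftSet, ← h4 i k τ hτ.1 hτ.2]
    exact hd'.hasDerivWithinAt
  have hreg : ∀ T' : ℝ, T' < T → ∃ M : ℝ, ∀ τ ∈ Icc (0 : ℝ) T', ∀ (i : Fin m) (k : ℤ),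
      (1 + (1 + ε₀) ^ ((10 : ℝ) * k)) * |X i k τ| ≤ M := by
    intro T' hT'
    rcases le_or_gt T' 0 with h0 | h0
    · obtain ⟨M, hM⟩ := h5 (T / 2) (by linarith) (by linarith)
      exact ⟨M, fun τ hτ i k => hM τ hτ.1 (by linarith [hτ.2]) i k⟩
    · obtain ⟨M, hM⟩ := h5 T' h0 hT'
      exact ⟨M, fun τ hτ i k => hM τ hτ.1 hτ.2 i k⟩
  have hunb : ∀ L : ℝ, ∃ τ ∈ Ico (0 : ℝ) T, ∃ (i : Fin m) (k : ℤ),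
      L < (1 + ε₀) ^ ((5 : ℝ) * k / 2) * |X i k τ| := fun L => by
    obtain ⟨τ, hτ0, hτT, i, k, h⟩ := h6 L
    exact ⟨τ, ⟨hτ0, hτT⟩, i, k, h⟩
  have key := critical_rate_lower_bound hε.le zero_le_one hα' hder hreg hunb t ht L (by simpa using hL)
  exact key

end BlowupRigidityOne

end Summit.NavierStokesRegularity.NavierStokesRegularity.Theorems

end
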